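import Summits.QuantumFields.YangMills.Theses.SoftLoopLongLag
import Literature.MathematicalPhysics.QuantumLattice.WilsonLoopsProofs

/-!
# Route `SoftLoopLongLag` — support item P `SoftLoopObsPosTime` (stmt-QuantumFields-22203), PROVED

For every compact group `G`, lattice representation `r` and `R : ℕ`, the cube-smeared time-zero soft-loop observable
`F(U) = Σ_{x ∈ [-R,R]⁴, x₀ = 0} (1/N) Re tr r(hol_{R×R loop at x in the (1,2) plane}(U))` is a positive-time observable in
the sense of the tree's `WeakCouplingRates.IsPosTimeObs`: a bounded continuous cylinder function supported on edges based
at sites with `x₀ ≥ 0` (in fact `x₀ = 0`: every dart of `rectWalk x 1 2 R R` has direction `1` or `2`, so the time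
coordinate is constant along the loop).  Bookkeeping only (Seiler LNP 159 §2: Wilson loops are local observables); the
continuity / cylinder facts are the tree's `continuous_wilsonLoopObs`, `isCylinder_wilsonLoopObs`.

HONEST LABEL: an item of a RECORD-label rung line (R2xi-G, leaf `WeakCouplingRates.XiPow`, an UPPER bound on the lattice
mass gap); NOT the Clay mass gap; no summit is proved.
-/

set_option autoImplicit false

noncomputable section

open MeasureTheory Filter Topology SimpleGraph
open Literature.Probability.LatticeModels
open Literature.MathematicalPhysics Literature.MathematicalPhysics.QuantumFieldTheory
open Literature.MathematicalPhysics.QuantumLattice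
open Summit.QuantumFields.YangMills.Theorems.WeakCouplingRates

namespace Summit.QuantumFields.YangMills.Theorems.SoftLoopLongLag

/-- Along a lattice walk none of whose darts points in direction `k`, the `k`-th coordinate of every visited site equals
that of the base point. -/
theorem apply_eq_of_mem_support_of_dartDir_ne {d : ℕ} {k : Fin d} :
    ∀ {x y : Site d} (w : (zdGraph d).Walk x y), (∀ e ∈ w.darts, dartDir e ≠ k) →
      ∀ v ∈ w.support, v k = x k
  | x, _, .nil, _, v, hv => by
      rw [Walk.support_nil, List.mem_singleton] at hv
      rw [hv]
  | x, y, .cons (v := z) h w', hdir, v, hv => by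
      rw [Walk.support_cons, List.mem_cons] at hv
      rcases hv with rfl | hv
      · rfl
      · have hd0 : dartDir (⟨(x, z), h⟩ : (zdGraph d).Dart) ≠ k :=
          hdir _ (by rw [Walk.darts_cons]; exact List.mem_cons_self)
        have hzk : z k = x k := by
          rcases dartDir_spec (⟨(x, z), h⟩ : (zdGraph d).Dart) with hz | hz
          · change z = x + _ at hz
            rw [hz, Pi.add_apply, Pi.single_eq_of_ne hd0.symm, add_zero]
          · change x = z + _ at hz
            rw [hz, Pi.add_apply, Pi.single_eq_of_ne hd0.symm, add_zero]
        have hw' : ∀ e ∈ w'.darts, dartDir e ≠ k := fun e he =>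
          hdir e (by rw [Walk.darts_cons]; exact List.mem_cons_of_mem _ he)
        rw [apply_eq_of_mem_support_of_dartDir_ne w' hw' v hv, hzk]

/-- The edge under a dart of such a walk is based at a site with the same `k`-th coordinate as the base point. -/
theorem dartStep_fst_apply_eq {d : ℕ} {k : Fin d} {x y : Site d} (w : (zdGraph d).Walk x y)
    (hw : ∀ e ∈ w.darts, dartDir e ≠ k) {e : (zdGraph d).Dart} (he : e ∈ w.darts) :
    (dartStep e).1.1 k = x k := by
  unfold dartStep
  split_ifs
  · exact apply_eq_of_mem_support_of_dartDir_ne w hw _ (w.dart_fst_mem_support_of_mem_darts he)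
  · exact apply_eq_of_mem_support_of_dartDir_ne w hw _ (w.dart_snd_mem_support_of_mem_darts he)

/-- Every edge under a dart of the spatial `R × T` loop `rectWalk x 1 2 R T` of `ℤ⁴` is based at a site with time
coordinate `x 0`. -/
theorem dartStep_rectWalk_time_eq (x : Site 4) (R T : ℕ) {e : (zdGraph 4).Dart}
    (he : e ∈ (rectWalk x 1 2 R T).darts) : (dartStep e).1.1 0 = x 0 := by
  refine dartStep_fst_apply_eq (rectWalk x 1 2 R T) (fun e' he' => ?_) he
  rcases isPlanarIn_rectWalk x 1 2 R T e' he' with h | h <;> rw [h] <;> decide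

/-- **Item P `SoftLoopObsPosTime` (stmt-QuantumFields-22203), PROVED.**  The cube-smeared time-zero soft-loop observable is a
positive-time observable: cylinder on the (time-zero, spatial) edges of the loops `rectWalk x 1 2 R R`, `x₀ = 0`;
continuous (`continuous_wilsonLoopObs`); bounded by `#(sites) · sup |χ|` (compactness of `G`).  Support item of the
RECORD-label rung line `SoftLoopLongLag` (R2xi-G); NOT the Clay mass gap. -/
theorem softLoopObsPosTime_proof : Summit.QuantumFields.YangMills.Theses.SoftLoopLongLag.SoftLoopObsPosTime := by
  intro G _ _ _ _ _ _ r R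
  set χ : G → ℝ := fun g => (r.N : ℝ)⁻¹ * (r.ρ g).trace.re with hχdef
  have hχ : Continuous χ := continuous_normalisedCharacter_comp r.continuous
  set sites : Finset (Site 4) := (box 4 R).filter (fun x => x 0 = 0) with hsites
  -- the supporting edge set: all edges under darts of the loops
  let S : Finset (QuantumLattice.ZdEdge 4) :=
    sites.biUnion fun x => ((rectWalk x 1 2 R R).darts.map fun e => (dartStep e).1).toFinset
  refine ⟨⟨S, ?_, ?_⟩, ?_, ?_⟩
  · -- cylinder
    intro U V hUV
    refine Finset.sum_congr rfl fun x hx => ?_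
    refine isCylinder_wilsonLoopObs χ (rectWalk x 1 2 R R) (fun e he => hUV e ?_)
    simp only [S, Finset.coe_biUnion, Finset.mem_coe, Set.mem_iUnion]
    exact ⟨x, hx, he⟩
  · -- positive (in fact zero) time
    intro e he
    simp only [S, Finset.mem_biUnion, List.mem_toFinset, List.mem_map] at he
    obtain ⟨x, hx, e', he', rfl⟩ := he
    have hx0 : x 0 = 0 := (Finset.mem_filter.1 hx).2
    rw [dartStep_rectWalk_time_eq x R R he', hx0]
  · -- continuity
    exact continuous_finsetSum _ fun x _ => continuous_wilsonLoopObs hχ _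
  · -- boundedness
    obtain ⟨C₀, hC₀⟩ := isCompact_univ.exists_bound_of_continuousOn hχ.continuousOn
    refine ⟨sites.card * C₀, fun U => ?_⟩
    calc |∑ x ∈ sites, wilsonLoopObs χ (rectWalk x 1 2 R R) U|
        ≤ ∑ x ∈ sites, |wilsonLoopObs χ (rectWalk x 1 2 R R) U| := Finset.abs_sum_le_sum_abs _ _
      _ ≤ ∑ _x ∈ sites, C₀ := Finset.sum_le_sum fun x _ => by
          simpa [Real.norm_eq_abs, wilsonLoopObs] using hC₀ (walkHolonomy U (rectWalk x 1 2 R R)) (Set.mem_univ _)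
      _ = sites.card * C₀ := by rw [Finset.sum_const, nsmul_eq_mul]

end Summit.QuantumFields.YangMills.Theorems.SoftLoopLongLag

end
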